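/-
# PROBE 25 (pub-hlocus ivhs-2, ENGINE B gen 56) — THE INTERIOR OF THE WINDOW: THE UNIT-COLUMN RANK DROP IS POSITIVE THROUGHOUT

certified instances and evidence bearing on the general Hodge conjecture; no claim.

For a prime `p > c ≥ 1` anchor 304 ((DROP) `rank_charP_add_eq_rank_charZero_add`) writes, for EVERY `k`, `e` and level `j`,
`rank_K + Σ_μ CORR_P(μ) = rank_{K₀} + Σ_μ CORR_0(μ)` for anchor 229's multiplicity matrix of `×q^c` on `K[x₁,…,x_k]/(xᵢ^{e+2})`, the
label sums running over `μ : Fin k → Fin (e+1)` with Wilson blocks `W_{T, T+c}(k − S)`, `S = #{i : μ i ≠ 0}`, `t = (j + Σμ)/(e+1) − S`,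
`T = min (t, k − S − t − c)`, `CORR_P = Σ_b C(k − S, T + c − (b+1)p)`, `CORR_0 = Σ_b C(k − S, T − (b+1)p)`.  PROBE 24 (READY, companion
sheet `UnitColumnRankDropWindow`) shows the drop vanishes outside the window `(e+1)(p − c) ≤ j ≤ (e+1)(k − p)` and equals one at its ends.
Here: THE DROP IS POSITIVE AT EVERY LEVEL OF THE CLOSED WINDOW.  Two elementary facts carry it: binomial coefficients increase strictly up
to the middle ((B1)/(B2)), so every label's characteristic-`0` term is dominated termwise by its characteristic-`p` term ((M) — the two sums
pair off `b ↦ b`, the arguments differ by `c`, and `2(T + c − (b+1)p) ≤ k − S` because `2T + c ≤ k − S` and `c < 2p`); and one label is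
STRICT ((CORE)): on the lattice levels `j = (e+1)m₀`, `p − c ≤ m₀ ≤ k − p`, the ZERO label ((S0): `T = min (m₀, k − c − m₀) ≥ p − c`, so
either `T ≥ p` and the `b = 0` terms differ strictly, or `T < p` and only the characteristic-`p` sum has a term, `C(k, T + c − p) ≥ 1`);
off the lattice (then `e ≥ 1`) the label with a single non-zero coordinate `e + 1 − (j mod (e+1))` ((S1): block on `k − 1` coordinates,
`t = (j + Σμ)/(e+1) − 1 ∈ [p − c, k − p − 1]`).  Hence, for a prime `p`, `1 ≤ c < p`, ANY `k`, `e`, a field `K` of characteristic `p` and a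
field `K₀` of characteristic `0`:
  (WIN-IN) `rank_charP_lt_rank_charZero_of_mem_window` — `(e+1)(p − c) ≤ j ≤ (e+1)(k − p)`  ⟹  `rank_K < rank_{K₀}`.
With PROBE 24's (WIN-OUT) the window is EXACTLY the set of levels where the characteristic-`p` rank drops (every `k ≥ 2p − c`; for
`k + c < 2p` the window is empty and there is no drop at all; `c = 0` is the identity map, no drop).
Own numerics FIRST (`probe25/interior_numerics.py`): anchor 304's closed form on 3 064 cells (p ≤ 11, 1 ≤ c < p, k ≤ 4p + 2, e ≤ 3;
151 834 levels): drop ≥ 1 at every window level (lattice levels: ≥ C(k, T + c − p) − C(k, T − p) ≥ 1; off-lattice: 37 968 levels, none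
zero; min lattice drop 1, at the ends), CORR_0(μ) ≤ CORR_P(μ) for every label class at every level, 0 bad, 30 s; consistent with
`probe24/window_numerics.out` (info: no window level with drop ≤ 0) and the LEAD's `gen57/reads/p24/own24.out` INFO line (interior drop ≥ 1
at 53/53 levels); ACTUAL ranks at every level of 2p − c ≤ k ≤ 2p + c + 3, p ≤ 5: kit j276459 (`probe24/window_ranks_kit.py`, record).
EVIDENCE CLASS: kernel theorems about the census matrices; no census number changes; nothing here asserts anything about the Hodge conjecture.

Import: anchor 320 `…Theorems.HodgeLocusCensusUnitColumnRankDropBandProfile` (hence 307 and 304 (DROP)); PROBE 24 is not needed.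
-/
import Summits.HodgeConjecture.HodgeConjecture.Theorems.HodgeLocusCensusUnitColumnRankDropBandProfile

set_option linter.dupNamespace false
set_option autoImplicit false

namespace Summit.HodgeConjecture.HodgeConjecture.HodgeLocus.Census.UnitColumnRankDropWindowInterior

open Summit.HodgeConjecture.HodgeConjecture.HodgeLocus.Census.ModelNonJumpC1All (colR)
open Summit.HodgeConjecture.HodgeConjecture.HodgeLocus.Census.UnitColumnRankDrop (rank_charP_add_eq_rank_charZero_add)

/-! ## §1 Binomial coefficients increase strictly up to the middle; the strict comparison of the two Wilson correction sums -/

/-- (B1) `C(m, x) ≤ C(m, y)` for `x ≤ y ≤ m/2` (iterating Mathlib's `Nat.choose_le_succ_of_lt_half_left`). -/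
theorem choose_le_choose_of_le_of_two_mul_le (m x y : ℕ) (hxy : x ≤ y) : 2 * y ≤ m → m.choose x ≤ m.choose y := by
  induction y, hxy using Nat.le_induction with
  | base => exact fun _ => le_rfl
  | succ n _ ih => exact fun hn => (ih (by omega)).trans (Nat.choose_le_succ_of_lt_half_left (by omega))

/-- (B2) `C(m, x) < C(m, y)` for `x < y ≤ m/2` ((B1) up to `y − 1`, then `C(m, y)·y = C(m, y−1)·(m − y + 1)` with `m − y + 1 > y`). -/
theorem choose_lt_choose_of_lt_of_two_mul_le (m x y : ℕ) (hxy : x < y) (hy : 2 * y ≤ m) : m.choose x < m.choose y := by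
  obtain ⟨n, rfl⟩ : ∃ n, y = n + 1 := ⟨y - 1, by omega⟩
  have h1 : m.choose x ≤ m.choose n := choose_le_choose_of_le_of_two_mul_le m x n (by omega) (by omega)
  have h2 := Nat.choose_succ_right_eq m n
  have hpos : 0 < m.choose n := Nat.choose_pos (by omega)
  refine lt_of_le_of_lt h1 (Nat.lt_of_not_le fun hc => ?_)
  have h3 : m.choose (n + 1) * (n + 1) ≤ m.choose n * (n + 1) := Nat.mul_le_mul_right _ hc
  rw [h2] at h3
  have h4 := Nat.le_of_mul_le_mul_left h3 hpos
  omega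

/-- (CORE) the strict comparison of the two Wilson correction sums of one block `W_{T, T+c}` on `m` coordinates when `1 ≤ c < p`,
`p ≤ T + c` and `2T + c ≤ m`: `Σ_{b < T/p} C(m, T − (b+1)p) < Σ_{b < (T+c)/p} C(m, T + c − (b+1)p)` — termwise `≤` by (B1), and either
`T ≥ p` (the `b = 0` terms differ strictly by (B2)) or `T < p` (the left sum is empty and the right one contains `C(m, T + c − p) ≥ 1`). -/
theorem sum_range_choose_lt (m T c p : ℕ) (hc : 0 < c) (hcp : c < p) (hpT : p ≤ T + c) (hTm : 2 * T + c ≤ m) :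
    ∑ b ∈ Finset.range (T / p), m.choose (T - (b + 1) * p) < ∑ b ∈ Finset.range ((T + c) / p), m.choose (T + c - (b + 1) * p) := by
  have hp0 : 0 < p := by omega
  by_cases hTp : p ≤ T
  · calc ∑ b ∈ Finset.range (T / p), m.choose (T - (b + 1) * p)
          < ∑ b ∈ Finset.range (T / p), m.choose (T + c - (b + 1) * p) :=
            Finset.sum_lt_sum (fun b hb => by
              have hbp : (b + 1) * p ≤ T := (Nat.le_div_iff_mul_le hp0).mp (Finset.mem_range.mp hb)
              have hp1 : p ≤ (b + 1) * p := Nat.le_mul_of_pos_left p (Nat.succ_pos b)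
              exact choose_le_choose_of_le_of_two_mul_le _ _ _ (by omega) (by omega))
              ⟨0, Finset.mem_range.mpr (Nat.div_pos hTp hp0), choose_lt_choose_of_lt_of_two_mul_le _ _ _ (by omega) (by omega)⟩
      _ ≤ ∑ b ∈ Finset.range ((T + c) / p), m.choose (T + c - (b + 1) * p) :=
            Finset.sum_le_sum_of_subset (Finset.range_mono (Nat.div_le_div_right (Nat.le_add_right T c)))
  · rw [Nat.div_eq_of_lt (by omega), Finset.range_zero, Finset.sum_empty]
    calc 0 < m.choose (T + c - (0 + 1) * p) := Nat.choose_pos (by omega)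
      _ ≤ ∑ b ∈ Finset.range ((T + c) / p), m.choose (T + c - (b + 1) * p) :=
            Finset.single_le_sum (f := fun b => m.choose (T + c - (b + 1) * p)) (fun _ _ => Nat.zero_le _)
              (Finset.mem_range.mpr (Nat.div_pos hpT hp0))

/-! ## §2 Per label: the characteristic-`0` correction term never exceeds the characteristic-`p` one; the strict labels -/

/-- (M) for EVERY label `μ` (and `c < p`) anchor 304's characteristic-`0` correction term is at most its characteristic-`p` term: the two
Wilson sums pair off `b ↦ b` (`T/p ≤ (T + c)/p`), the binomial arguments differ by `c`, and `2(T + c − (b+1)p) ≤ k − S` by `2T + c ≤ k − S`,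
`p ≤ (b+1)p`, `c < p` ((B1)); both if-conditions are the same on the two sides. -/
theorem corr0_le_corrP (p k e c j : ℕ) (μ : Fin k → Fin (e + 1)) (hcp : c < p) :
        (if (e + 1) ∣ (j + ∑ i, (μ i : ℕ)) ∧ (e + 1) * (Finset.univ.filter (fun l => (μ l : ℕ) ≠ 0)).card ≤ j + ∑ i, (μ i : ℕ) then
          (if k - (Finset.univ.filter (fun l => (μ l : ℕ) ≠ 0)).card < ((j + ∑ i, (μ i : ℕ)) / (e + 1) - (Finset.univ.filter (fun l => (μ l : ℕ) ≠ 0)).card) + c then 0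
           else ∑ b ∈ Finset.range ((min ((j + ∑ i, (μ i : ℕ)) / (e + 1) - (Finset.univ.filter (fun l => (μ l : ℕ) ≠ 0)).card)
               (k - (Finset.univ.filter (fun l => (μ l : ℕ) ≠ 0)).card -
                 ((j + ∑ i, (μ i : ℕ)) / (e + 1) - (Finset.univ.filter (fun l => (μ l : ℕ) ≠ 0)).card) - c)) / p),
             (k - (Finset.univ.filter (fun l => (μ l : ℕ) ≠ 0)).card).choose (min ((j + ∑ i, (μ i : ℕ)) / (e + 1) - (Finset.univ.filter (fun l => (μ l : ℕ) ≠ 0)).card)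
               (k - (Finset.univ.filter (fun l => (μ l : ℕ) ≠ 0)).card -
                 ((j + ∑ i, (μ i : ℕ)) / (e + 1) - (Finset.univ.filter (fun l => (μ l : ℕ) ≠ 0)).card) - c) - (b + 1) * p))
         else 0) ≤
        (if (e + 1) ∣ (j + ∑ i, (μ i : ℕ)) ∧ (e + 1) * (Finset.univ.filter (fun l => (μ l : ℕ) ≠ 0)).card ≤ j + ∑ i, (μ i : ℕ) then
          (if k - (Finset.univ.filter (fun l => (μ l : ℕ) ≠ 0)).card < ((j + ∑ i, (μ i : ℕ)) / (e + 1) - (Finset.univ.filter (fun l => (μ l : ℕ) ≠ 0)).card) + c then 0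
           else ∑ b ∈ Finset.range ((min ((j + ∑ i, (μ i : ℕ)) / (e + 1) - (Finset.univ.filter (fun l => (μ l : ℕ) ≠ 0)).card)
               (k - (Finset.univ.filter (fun l => (μ l : ℕ) ≠ 0)).card -
                 ((j + ∑ i, (μ i : ℕ)) / (e + 1) - (Finset.univ.filter (fun l => (μ l : ℕ) ≠ 0)).card) - c) + c) / p),
             (k - (Finset.univ.filter (fun l => (μ l : ℕ) ≠ 0)).card).choose (min ((j + ∑ i, (μ i : ℕ)) / (e + 1) - (Finset.univ.filter (fun l => (μ l : ℕ) ≠ 0)).card)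
               (k - (Finset.univ.filter (fun l => (μ l : ℕ) ≠ 0)).card -
                 ((j + ∑ i, (μ i : ℕ)) / (e + 1) - (Finset.univ.filter (fun l => (μ l : ℕ) ≠ 0)).card) - c) + c - (b + 1) * p))
         else 0) := by
  generalize (Finset.univ.filter (fun l => (μ l : ℕ) ≠ 0)).card = S
  generalize (∑ i, (μ i : ℕ)) = σ
  generalize (j + σ) / (e + 1) = q
  generalize k - S = m
  generalize q - S = t
  generalize hT : min t (m - t - c) = T
  have hT1 : T ≤ t := hT ▸ min_le_left _ _
  have hT2 : T ≤ m - t - c := hT ▸ min_le_right _ _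
  have hp0 : 0 < p := by omega
  split_ifs with hF hlt
  · exact le_rfl
  · calc ∑ b ∈ Finset.range (T / p), m.choose (T - (b + 1) * p)
          ≤ ∑ b ∈ Finset.range (T / p), m.choose (T + c - (b + 1) * p) := Finset.sum_le_sum (fun b hb => by
            have hbp : (b + 1) * p ≤ T := (Nat.le_div_iff_mul_le hp0).mp (Finset.mem_range.mp hb)
            have hp1 : p ≤ (b + 1) * p := Nat.le_mul_of_pos_left p (Nat.succ_pos b)
            exact choose_le_choose_of_le_of_two_mul_le _ _ _ (by omega) (by omega))
      _ ≤ ∑ b ∈ Finset.range ((T + c) / p), m.choose (T + c - (b + 1) * p) :=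
            Finset.sum_le_sum_of_subset (Finset.range_mono (Nat.div_le_div_right (Nat.le_add_right T c)))
  · exact le_rfl

/-- (S0) THE ZERO LABEL IS STRICT ON THE LATTICE LEVELS OF THE CLOSED WINDOW: for `j = (e+1)m₀` with `p − c ≤ m₀ ≤ k − p` and `1 ≤ c < p`
its block is `c!·W_{T, T+c}` on all `k` coordinates with `T = min (m₀, k − c − m₀) ≥ p − c`, and (CORE) applies. -/
theorem corr0_lt_corrP_zero_label (p k e c j m₀ : ℕ) (μ : Fin k → Fin (e + 1)) (hμ : μ = fun _ => 0) (hc : 0 < c) (hcp : c < p)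
    (hj : j = (e + 1) * m₀) (h1 : p - c ≤ m₀) (h2 : m₀ + p ≤ k) :
        (if (e + 1) ∣ (j + ∑ i, (μ i : ℕ)) ∧ (e + 1) * (Finset.univ.filter (fun l => (μ l : ℕ) ≠ 0)).card ≤ j + ∑ i, (μ i : ℕ) then
          (if k - (Finset.univ.filter (fun l => (μ l : ℕ) ≠ 0)).card < ((j + ∑ i, (μ i : ℕ)) / (e + 1) - (Finset.univ.filter (fun l => (μ l : ℕ) ≠ 0)).card) + c then 0
           else ∑ b ∈ Finset.range ((min ((j + ∑ i, (μ i : ℕ)) / (e + 1) - (Finset.univ.filter (fun l => (μ l : ℕ) ≠ 0)).card)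
               (k - (Finset.univ.filter (fun l => (μ l : ℕ) ≠ 0)).card -
                 ((j + ∑ i, (μ i : ℕ)) / (e + 1) - (Finset.univ.filter (fun l => (μ l : ℕ) ≠ 0)).card) - c)) / p),
             (k - (Finset.univ.filter (fun l => (μ l : ℕ) ≠ 0)).card).choose (min ((j + ∑ i, (μ i : ℕ)) / (e + 1) - (Finset.univ.filter (fun l => (μ l : ℕ) ≠ 0)).card)
               (k - (Finset.univ.filter (fun l => (μ l : ℕ) ≠ 0)).card -
                 ((j + ∑ i, (μ i : ℕ)) / (e + 1) - (Finset.univ.filter (fun l => (μ l : ℕ) ≠ 0)).card) - c) - (b + 1) * p))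
         else 0) <
        (if (e + 1) ∣ (j + ∑ i, (μ i : ℕ)) ∧ (e + 1) * (Finset.univ.filter (fun l => (μ l : ℕ) ≠ 0)).card ≤ j + ∑ i, (μ i : ℕ) then
          (if k - (Finset.univ.filter (fun l => (μ l : ℕ) ≠ 0)).card < ((j + ∑ i, (μ i : ℕ)) / (e + 1) - (Finset.univ.filter (fun l => (μ l : ℕ) ≠ 0)).card) + c then 0
           else ∑ b ∈ Finset.range ((min ((j + ∑ i, (μ i : ℕ)) / (e + 1) - (Finset.univ.filter (fun l => (μ l : ℕ) ≠ 0)).card)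
               (k - (Finset.univ.filter (fun l => (μ l : ℕ) ≠ 0)).card -
                 ((j + ∑ i, (μ i : ℕ)) / (e + 1) - (Finset.univ.filter (fun l => (μ l : ℕ) ≠ 0)).card) - c) + c) / p),
             (k - (Finset.univ.filter (fun l => (μ l : ℕ) ≠ 0)).card).choose (min ((j + ∑ i, (μ i : ℕ)) / (e + 1) - (Finset.univ.filter (fun l => (μ l : ℕ) ≠ 0)).card)
               (k - (Finset.univ.filter (fun l => (μ l : ℕ) ≠ 0)).card -
                 ((j + ∑ i, (μ i : ℕ)) / (e + 1) - (Finset.univ.filter (fun l => (μ l : ℕ) ≠ 0)).card) - c) + c - (b + 1) * p))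
         else 0) := by
  subst hμ
  have hs : (Finset.univ.filter (fun l : Fin k => (((fun _ => (0 : Fin (e + 1))) l : Fin (e + 1)) : ℕ) ≠ 0)).card = 0 := by simp
  have hsum : (∑ i : Fin k, (((fun _ => (0 : Fin (e + 1))) i : Fin (e + 1)) : ℕ)) = 0 := by simp
  simp only [hs, hsum, add_zero, mul_zero, Nat.sub_zero]
  subst hj
  have hF : (e + 1) ∣ (e + 1) * m₀ ∧ 0 ≤ (e + 1) * m₀ := ⟨Dvd.intro _ rfl, Nat.zero_le _⟩
  rw [if_pos hF, if_pos hF, Nat.mul_div_cancel_left m₀ (Nat.succ_pos e)]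
  have hn : ¬ (k < m₀ + c) := by omega
  rw [if_neg hn, if_neg hn]
  generalize hT : min m₀ (k - m₀ - c) = T
  have hT' : p ≤ T + c ∧ 2 * T + c ≤ k := by rw [← hT, Nat.min_def]; split_ifs <;> omega
  exact sum_range_choose_lt k T c p hc hcp hT'.1 hT'.2

/-- (S1) A SINGLE-COORDINATE LABEL IS STRICT OFF THE LATTICE: the label with one non-zero coordinate `i₀`, of value `S ∈ [1, e]`, at a level
with `(e+1) ∣ (j + S)`, `(e+1)(p − c) < j + S ≤ (e+1)(k − p)` and `1 ≤ c < p`: its block lives on `k − 1` coordinates with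
`t = (j + S)/(e+1) − 1 ∈ [p − c, k − p − 1]`, so `T = min (t, k − 1 − t − c) ≥ p − c` and (CORE) applies. -/
theorem corr0_lt_corrP_single (p k e c j S : ℕ) (i₀ : Fin k) (hS1 : 0 < S) (hSe : S < e + 1) (μ : Fin k → Fin (e + 1))
    (hμ : μ = fun i => ⟨if i = i₀ then S else 0, by split_ifs <;> omega⟩) (hlo : (e + 1) * (p - c) < j + S)
    (hhi : j + S ≤ (e + 1) * (k - p)) (hdvd : (e + 1) ∣ (j + S)) (hc : 0 < c) (hcp : c < p) :
        (if (e + 1) ∣ (j + ∑ i, (μ i : ℕ)) ∧ (e + 1) * (Finset.univ.filter (fun l => (μ l : ℕ) ≠ 0)).card ≤ j + ∑ i, (μ i : ℕ) then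
          (if k - (Finset.univ.filter (fun l => (μ l : ℕ) ≠ 0)).card < ((j + ∑ i, (μ i : ℕ)) / (e + 1) - (Finset.univ.filter (fun l => (μ l : ℕ) ≠ 0)).card) + c then 0
           else ∑ b ∈ Finset.range ((min ((j + ∑ i, (μ i : ℕ)) / (e + 1) - (Finset.univ.filter (fun l => (μ l : ℕ) ≠ 0)).card)
               (k - (Finset.univ.filter (fun l => (μ l : ℕ) ≠ 0)).card -
                 ((j + ∑ i, (μ i : ℕ)) / (e + 1) - (Finset.univ.filter (fun l => (μ l : ℕ) ≠ 0)).card) - c)) / p),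
             (k - (Finset.univ.filter (fun l => (μ l : ℕ) ≠ 0)).card).choose (min ((j + ∑ i, (μ i : ℕ)) / (e + 1) - (Finset.univ.filter (fun l => (μ l : ℕ) ≠ 0)).card)
               (k - (Finset.univ.filter (fun l => (μ l : ℕ) ≠ 0)).card -
                 ((j + ∑ i, (μ i : ℕ)) / (e + 1) - (Finset.univ.filter (fun l => (μ l : ℕ) ≠ 0)).card) - c) - (b + 1) * p))
         else 0) <
        (if (e + 1) ∣ (j + ∑ i, (μ i : ℕ)) ∧ (e + 1) * (Finset.univ.filter (fun l => (μ l : ℕ) ≠ 0)).card ≤ j + ∑ i, (μ i : ℕ) then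
          (if k - (Finset.univ.filter (fun l => (μ l : ℕ) ≠ 0)).card < ((j + ∑ i, (μ i : ℕ)) / (e + 1) - (Finset.univ.filter (fun l => (μ l : ℕ) ≠ 0)).card) + c then 0
           else ∑ b ∈ Finset.range ((min ((j + ∑ i, (μ i : ℕ)) / (e + 1) - (Finset.univ.filter (fun l => (μ l : ℕ) ≠ 0)).card)
               (k - (Finset.univ.filter (fun l => (μ l : ℕ) ≠ 0)).card -
                 ((j + ∑ i, (μ i : ℕ)) / (e + 1) - (Finset.univ.filter (fun l => (μ l : ℕ) ≠ 0)).card) - c) + c) / p),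
             (k - (Finset.univ.filter (fun l => (μ l : ℕ) ≠ 0)).card).choose (min ((j + ∑ i, (μ i : ℕ)) / (e + 1) - (Finset.univ.filter (fun l => (μ l : ℕ) ≠ 0)).card)
               (k - (Finset.univ.filter (fun l => (μ l : ℕ) ≠ 0)).card -
                 ((j + ∑ i, (μ i : ℕ)) / (e + 1) - (Finset.univ.filter (fun l => (μ l : ℕ) ≠ 0)).card) - c) + c - (b + 1) * p))
         else 0) := by
  have hcard : (Finset.univ.filter (fun l => (μ l : ℕ) ≠ 0)).card = 1 := by
    subst hμ
    rw [Finset.card_eq_one]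
    exact ⟨i₀, by ext l; by_cases hl : l = i₀ <;> simp [hl, hS1.ne']⟩
  have hsum : (∑ i, (μ i : ℕ)) = S := by subst hμ; simp
  rw [hcard, hsum]
  obtain ⟨q, hq⟩ := hdvd
  rw [hq] at hlo hhi
  rw [hq, Nat.mul_div_cancel_left q (Nat.succ_pos e)]
  have hq1 : p - c < q := Nat.lt_of_mul_lt_mul_left hlo
  have hq2 : q ≤ k - p := Nat.le_of_mul_le_mul_left hhi (Nat.succ_pos e)
  have hF : (e + 1) ∣ (e + 1) * q ∧ (e + 1) * 1 ≤ (e + 1) * q := ⟨Dvd.intro _ rfl, Nat.mul_le_mul_left _ (by omega)⟩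
  rw [if_pos hF, if_pos hF]
  have hn : ¬ (k - 1 < q - 1 + c) := by omega
  rw [if_neg hn, if_neg hn]
  generalize hT : min (q - 1) (k - 1 - (q - 1) - c) = T
  have hT' : p ≤ T + c ∧ 2 * T + c ≤ k - 1 := by rw [← hT, Nat.min_def]; split_ifs <;> omega
  exact sum_range_choose_lt (k - 1) T c p hc hcp hT'.1 hT'.2

/-! ## §3 The headline: a positive drop at every level of the closed window, every `k` -/

/-- **(WIN-IN) THE DROP IS POSITIVE THROUGHOUT THE WINDOW, EVERY `k`.** For a prime `p`, `1 ≤ c < p`, any `k`, `e` and a level `j` with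
`(e+1)(p − c) ≤ j ≤ (e+1)(k − p)`: anchor 229's multiplicity matrix of `×q^c` at level `j` (VERBATIM) has STRICTLY SMALLER rank over a field
`K` of characteristic `p` than over a field `K₀` of characteristic `0` ((DROP) with (M) on every label and one strict label: the zero label
(S0) when `(e+1) ∣ j`, otherwise the single-coordinate label of value `e + 1 − (j mod (e+1))` at coordinate `0` (S1)).  With PROBE 24's
(WIN-OUT)/(WIN-ENDS): the window is exactly the support of the drop, and the drop is one at both ends. -/
theorem rank_charP_lt_rank_charZero_of_mem_window (K K₀ : Type*) [Field K] [Field K₀] (p : ℕ) [CharP K p] [CharZero K₀]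
    (hp : p.Prime) (k e c j : ℕ) (hc : 0 < c) (hcp : c < p) (hj1 : (e + 1) * (p - c) ≤ j) (hj2 : j ≤ (e + 1) * (k - p)) :
    (Matrix.of fun (v : {v : Fin k → Fin (e + 2) // (∑ i, (v i : ℕ)) + j = k * (e + 1)})
        (m : {m : Fin k → Fin (e + 2) // (∑ i, (m i : ℕ)) + (j + c * (e + 1)) = k * (e + 1)}) =>
      ((((List.flatMap (colR (e + 3)))^[c] [List.ofFn (fun i => (m.1 i : ℕ))]).count (List.ofFn (fun i => (v.1 i : ℕ))) : ℕ) : K)).rank <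
    (Matrix.of fun (v : {v : Fin k → Fin (e + 2) // (∑ i, (v i : ℕ)) + j = k * (e + 1)})
        (m : {m : Fin k → Fin (e + 2) // (∑ i, (m i : ℕ)) + (j + c * (e + 1)) = k * (e + 1)}) =>
      ((((List.flatMap (colR (e + 3)))^[c] [List.ofFn (fun i => (m.1 i : ℕ))]).count (List.ofFn (fun i => (v.1 i : ℕ))) : ℕ) : K₀)).rank := by
  have h := rank_charP_add_eq_rank_charZero_add K K₀ p hp k e c j hcp
  have hle : ∀ μ ∈ (Finset.univ : Finset (Fin k → Fin (e + 1))),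
        (if (e + 1) ∣ (j + ∑ i, (μ i : ℕ)) ∧ (e + 1) * (Finset.univ.filter (fun l => (μ l : ℕ) ≠ 0)).card ≤ j + ∑ i, (μ i : ℕ) then
          (if k - (Finset.univ.filter (fun l => (μ l : ℕ) ≠ 0)).card < ((j + ∑ i, (μ i : ℕ)) / (e + 1) - (Finset.univ.filter (fun l => (μ l : ℕ) ≠ 0)).card) + c then 0
           else ∑ b ∈ Finset.range ((min ((j + ∑ i, (μ i : ℕ)) / (e + 1) - (Finset.univ.filter (fun l => (μ l : ℕ) ≠ 0)).card)
               (k - (Finset.univ.filter (fun l => (μ l : ℕ) ≠ 0)).card -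
                 ((j + ∑ i, (μ i : ℕ)) / (e + 1) - (Finset.univ.filter (fun l => (μ l : ℕ) ≠ 0)).card) - c)) / p),
             (k - (Finset.univ.filter (fun l => (μ l : ℕ) ≠ 0)).card).choose (min ((j + ∑ i, (μ i : ℕ)) / (e + 1) - (Finset.univ.filter (fun l => (μ l : ℕ) ≠ 0)).card)
               (k - (Finset.univ.filter (fun l => (μ l : ℕ) ≠ 0)).card -
                 ((j + ∑ i, (μ i : ℕ)) / (e + 1) - (Finset.univ.filter (fun l => (μ l : ℕ) ≠ 0)).card) - c) - (b + 1) * p))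
         else 0) ≤
        (if (e + 1) ∣ (j + ∑ i, (μ i : ℕ)) ∧ (e + 1) * (Finset.univ.filter (fun l => (μ l : ℕ) ≠ 0)).card ≤ j + ∑ i, (μ i : ℕ) then
          (if k - (Finset.univ.filter (fun l => (μ l : ℕ) ≠ 0)).card < ((j + ∑ i, (μ i : ℕ)) / (e + 1) - (Finset.univ.filter (fun l => (μ l : ℕ) ≠ 0)).card) + c then 0
           else ∑ b ∈ Finset.range ((min ((j + ∑ i, (μ i : ℕ)) / (e + 1) - (Finset.univ.filter (fun l => (μ l : ℕ) ≠ 0)).card)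
               (k - (Finset.univ.filter (fun l => (μ l : ℕ) ≠ 0)).card -
                 ((j + ∑ i, (μ i : ℕ)) / (e + 1) - (Finset.univ.filter (fun l => (μ l : ℕ) ≠ 0)).card) - c) + c) / p),
             (k - (Finset.univ.filter (fun l => (μ l : ℕ) ≠ 0)).card).choose (min ((j + ∑ i, (μ i : ℕ)) / (e + 1) - (Finset.univ.filter (fun l => (μ l : ℕ) ≠ 0)).card)
               (k - (Finset.univ.filter (fun l => (μ l : ℕ) ≠ 0)).card -
                 ((j + ∑ i, (μ i : ℕ)) / (e + 1) - (Finset.univ.filter (fun l => (μ l : ℕ) ≠ 0)).card) - c) + c - (b + 1) * p))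
         else 0) := fun μ _ => corr0_le_corrP p k e c j μ hcp
  have hpc : 0 < p - c := Nat.sub_pos_of_lt hcp
  have hkp : p < k := by
    refine Nat.lt_of_not_le fun hk => ?_
    rw [Nat.sub_eq_zero_of_le hk, mul_zero, Nat.le_zero] at hj2
    rw [hj2, Nat.le_zero, Nat.mul_eq_zero] at hj1
    rcases hj1 with h0 | h0 <;> omega
  suffices hlt : ∃ μ ∈ (Finset.univ : Finset (Fin k → Fin (e + 1))),
        (if (e + 1) ∣ (j + ∑ i, (μ i : ℕ)) ∧ (e + 1) * (Finset.univ.filter (fun l => (μ l : ℕ) ≠ 0)).card ≤ j + ∑ i, (μ i : ℕ) then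
          (if k - (Finset.univ.filter (fun l => (μ l : ℕ) ≠ 0)).card < ((j + ∑ i, (μ i : ℕ)) / (e + 1) - (Finset.univ.filter (fun l => (μ l : ℕ) ≠ 0)).card) + c then 0
           else ∑ b ∈ Finset.range ((min ((j + ∑ i, (μ i : ℕ)) / (e + 1) - (Finset.univ.filter (fun l => (μ l : ℕ) ≠ 0)).card)
               (k - (Finset.univ.filter (fun l => (μ l : ℕ) ≠ 0)).card -
                 ((j + ∑ i, (μ i : ℕ)) / (e + 1) - (Finset.univ.filter (fun l => (μ l : ℕ) ≠ 0)).card) - c)) / p),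
             (k - (Finset.univ.filter (fun l => (μ l : ℕ) ≠ 0)).card).choose (min ((j + ∑ i, (μ i : ℕ)) / (e + 1) - (Finset.univ.filter (fun l => (μ l : ℕ) ≠ 0)).card)
               (k - (Finset.univ.filter (fun l => (μ l : ℕ) ≠ 0)).card -
                 ((j + ∑ i, (μ i : ℕ)) / (e + 1) - (Finset.univ.filter (fun l => (μ l : ℕ) ≠ 0)).card) - c) - (b + 1) * p))
         else 0) <
        (if (e + 1) ∣ (j + ∑ i, (μ i : ℕ)) ∧ (e + 1) * (Finset.univ.filter (fun l => (μ l : ℕ) ≠ 0)).card ≤ j + ∑ i, (μ i : ℕ) then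
          (if k - (Finset.univ.filter (fun l => (μ l : ℕ) ≠ 0)).card < ((j + ∑ i, (μ i : ℕ)) / (e + 1) - (Finset.univ.filter (fun l => (μ l : ℕ) ≠ 0)).card) + c then 0
           else ∑ b ∈ Finset.range ((min ((j + ∑ i, (μ i : ℕ)) / (e + 1) - (Finset.univ.filter (fun l => (μ l : ℕ) ≠ 0)).card)
               (k - (Finset.univ.filter (fun l => (μ l : ℕ) ≠ 0)).card -
                 ((j + ∑ i, (μ i : ℕ)) / (e + 1) - (Finset.univ.filter (fun l => (μ l : ℕ) ≠ 0)).card) - c) + c) / p),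
             (k - (Finset.univ.filter (fun l => (μ l : ℕ) ≠ 0)).card).choose (min ((j + ∑ i, (μ i : ℕ)) / (e + 1) - (Finset.univ.filter (fun l => (μ l : ℕ) ≠ 0)).card)
               (k - (Finset.univ.filter (fun l => (μ l : ℕ) ≠ 0)).card -
                 ((j + ∑ i, (μ i : ℕ)) / (e + 1) - (Finset.univ.filter (fun l => (μ l : ℕ) ≠ 0)).card) - c) + c - (b + 1) * p))
         else 0) by
    have hsum : (∑ μ : Fin k → Fin (e + 1),
        (if (e + 1) ∣ (j + ∑ i, (μ i : ℕ)) ∧ (e + 1) * (Finset.univ.filter (fun l => (μ l : ℕ) ≠ 0)).card ≤ j + ∑ i, (μ i : ℕ) then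
          (if k - (Finset.univ.filter (fun l => (μ l : ℕ) ≠ 0)).card < ((j + ∑ i, (μ i : ℕ)) / (e + 1) - (Finset.univ.filter (fun l => (μ l : ℕ) ≠ 0)).card) + c then 0
           else ∑ b ∈ Finset.range ((min ((j + ∑ i, (μ i : ℕ)) / (e + 1) - (Finset.univ.filter (fun l => (μ l : ℕ) ≠ 0)).card)
               (k - (Finset.univ.filter (fun l => (μ l : ℕ) ≠ 0)).card -
                 ((j + ∑ i, (μ i : ℕ)) / (e + 1) - (Finset.univ.filter (fun l => (μ l : ℕ) ≠ 0)).card) - c)) / p),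
             (k - (Finset.univ.filter (fun l => (μ l : ℕ) ≠ 0)).card).choose (min ((j + ∑ i, (μ i : ℕ)) / (e + 1) - (Finset.univ.filter (fun l => (μ l : ℕ) ≠ 0)).card)
               (k - (Finset.univ.filter (fun l => (μ l : ℕ) ≠ 0)).card -
                 ((j + ∑ i, (μ i : ℕ)) / (e + 1) - (Finset.univ.filter (fun l => (μ l : ℕ) ≠ 0)).card) - c) - (b + 1) * p))
         else 0)) <
        ∑ μ : Fin k → Fin (e + 1),
        (if (e + 1) ∣ (j + ∑ i, (μ i : ℕ)) ∧ (e + 1) * (Finset.univ.filter (fun l => (μ l : ℕ) ≠ 0)).card ≤ j + ∑ i, (μ i : ℕ) then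
          (if k - (Finset.univ.filter (fun l => (μ l : ℕ) ≠ 0)).card < ((j + ∑ i, (μ i : ℕ)) / (e + 1) - (Finset.univ.filter (fun l => (μ l : ℕ) ≠ 0)).card) + c then 0
           else ∑ b ∈ Finset.range ((min ((j + ∑ i, (μ i : ℕ)) / (e + 1) - (Finset.univ.filter (fun l => (μ l : ℕ) ≠ 0)).card)
               (k - (Finset.univ.filter (fun l => (μ l : ℕ) ≠ 0)).card -
                 ((j + ∑ i, (μ i : ℕ)) / (e + 1) - (Finset.univ.filter (fun l => (μ l : ℕ) ≠ 0)).card) - c) + c) / p),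
             (k - (Finset.univ.filter (fun l => (μ l : ℕ) ≠ 0)).card).choose (min ((j + ∑ i, (μ i : ℕ)) / (e + 1) - (Finset.univ.filter (fun l => (μ l : ℕ) ≠ 0)).card)
               (k - (Finset.univ.filter (fun l => (μ l : ℕ) ≠ 0)).card -
                 ((j + ∑ i, (μ i : ℕ)) / (e + 1) - (Finset.univ.filter (fun l => (μ l : ℕ) ≠ 0)).card) - c) + c - (b + 1) * p))
         else 0) := Finset.sum_lt_sum hle hlt
    omega
  by_cases hdvd : (e + 1) ∣ j
  · obtain ⟨m₀, hm₀⟩ := hdvd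
    have h1 : p - c ≤ m₀ := Nat.le_of_mul_le_mul_left (hm₀ ▸ hj1) (Nat.succ_pos e)
    have h2 : m₀ ≤ k - p := Nat.le_of_mul_le_mul_left (hm₀ ▸ hj2) (Nat.succ_pos e)
    exact ⟨fun _ => 0, Finset.mem_univ _, corr0_lt_corrP_zero_label p k e c j m₀ _ rfl hc hcp hm₀ h1 (by omega)⟩
  · have hk0 : 0 < k := by omega
    have hmod : 0 < j % (e + 1) := Nat.pos_of_ne_zero fun h0 => hdvd (Nat.dvd_of_mod_eq_zero h0)
    have hmlt : j % (e + 1) < e + 1 := Nat.mod_lt _ (Nat.succ_pos e)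
    have hne : j ≠ (e + 1) * (k - p) := fun hj => hdvd ⟨k - p, hj⟩
    have hjlt : j < (k - p) * (e + 1) := by rw [Nat.mul_comm]; exact lt_of_le_of_ne hj2 hne
    have hdiv : j / (e + 1) < k - p := (Nat.div_lt_iff_lt_mul (Nat.succ_pos e)).mpr hjlt
    have heq : j + (e + 1 - j % (e + 1)) = (e + 1) * (j / (e + 1) + 1) := by
      rw [Nat.mul_add, Nat.mul_one]; have := Nat.div_add_mod j (e + 1); omega
    have hhi : j + (e + 1 - j % (e + 1)) ≤ (e + 1) * (k - p) := by rw [heq]; exact Nat.mul_le_mul_left _ hdiv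
    exact ⟨_, Finset.mem_univ _, corr0_lt_corrP_single p k e c j (e + 1 - j % (e + 1)) ⟨0, hk0⟩ (by omega) (by omega) _ rfl
      (by omega) hhi ⟨j / (e + 1) + 1, heq⟩ hc hcp⟩

end Summit.HodgeConjecture.HodgeConjecture.HodgeLocus.Census.UnitColumnRankDropWindowInterior
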